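import Summits.CriticalPhenomena.PercolationContinuityZ3.Theorems.Transplant.SiteThmASocketZd
import Literature.Probability.Percolation.SiteBondCriticalPoints
import HarnessLib

/-!
# SITE percolation on `ℤ^d`: the socket of class C1a restricted to densities BELOW ONE — the site same-`p` witness for
# `p < 1` implies `θ^{site}_{ℤ^d}(p_c^{site}) = 0` (because `p_c^{site}(ℤ^d) < 1`, `d ≥ 2`); at `d = 3`, `SitePercolationContinuityZ3`

builds on p205010 (kernel theorem, internal audit signed; external expert review pending).
Lane `prim-bschramm`, class C1a (site percolation on `ℤ³`), seat p1 gen 3.  Site twin of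
`SameP.SamePWitnessLtOne` / `theta_criticalProb_eq_zero_of_samePWitnessLtOne` (bond, `PercNearOneGluingNoHeavySamePWitnessZd.lean`).

Why this file: the site re-typing of Kozma–Nitzan §4 (site Lemma 10 `SiteKN.siteTargetLemma`, site Lemmas 11–12
`SiteKN.siteIsHittable_elongGeom_of_theta`, `SiteKN.siteCorridorLemma_of_theta`) produces the exploration scheme only for
`0 < p < 1` (finite energy, `(1-p)`-powers), exactly as the bond chain; the socket `SiteSamePWitnessZd d` quantifies over every `p`
with `θ^{site}(p) > 0`, including `p = 1`.  The restricted socket below suffices, since Theorem A only evaluates the witness at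
`p = p_c^{site}(ℤ^d) < 1` (`siteCriticalProb_zd_lt_one`).

* `SiteSamePWitnessLtOneZd d` — as `SiteSamePWitnessZd d`, restricted to `p < 1`; `siteSamePWitnessLtOneZd_of_siteSamePWitnessZd`;
* `siteTheta_criticalProb_eq_zero_of_schemes_ltOne` — the abstract site closing argument with schemes only below one and `p_c^{site} < 1`
  (any countable locally finite graph, any star carrier);
* **`sitePercolationContinuity_of_siteSamePWitnessLtOneZd`** (`d ≥ 2`) and **`sitePercolationContinuityZ3_of_siteSamePWitnessLtOneZd`**.
[cite: KozmaNitzan2024, §1 p. 2 (approach 1), §4 p. 25] [cite: BenjaminiSchramm1996, Conj. 4]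
-/

noncomputable section

namespace Summit.CriticalPhenomena.PercolationContinuityZ3.Theorems.Transplant

namespace SiteSameP

open MeasureTheory Literature.Probability.Percolation Literature.Probability.LatticeModels
open SiteStar (starRead top_adj_none_some)

/-- **INPUT (FSW<1)-site for `ℤ^d` at the origin**: as `SiteSamePWitnessZd d`, at every density `p < 1` with `θ^{site}_{ℤ^d,0}(p) > 0`
(a `Prop`, never asserted). [cite: KozmaNitzan2024, §4 p. 25 (Definition of an exploration process)] -/
@[conjecture] def SiteSamePWitnessLtOneZd (d : ℕ) : Prop :=
  ∀ p : unitInterval, (p : ℝ) < 1 → 0 < siteTheta (zdGraph d) (0 : Site d) p →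
    ∃ (S : HSiteScheme (Option (Site d))) (ε : ℝ) (N : ℕ), S.Lawful (⊤ : SimpleGraph (Option (Site d))) p ε ∧ ε < (1 / 2) ^ 32 ∧
      (∀ hh P, S.E.next hh = some P → P.env.card ≤ N) ∧
      (↑S.U₀ : Set (Sym2 (Option (Site d)))) ⊆ (⊤ : SimpleGraph (Option (Site d))).edgeSet ∧
      S.initEvent ∩ {ω | (S.occFinal ω).Infinite} ⊆
        starRead ⁻¹' sitePercolatesAt (zdGraph d) (0 : Site d) ∪ {ω | ¬ω ⊆ (⊤ : SimpleGraph (Option (Site d))).edgeSet}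

/-- The unrestricted socket implies the restricted one. [folklore] -/
theorem siteSamePWitnessLtOneZd_of_siteSamePWitnessZd (d : ℕ) (h : SiteSamePWitnessZd d) : SiteSamePWitnessLtOneZd d :=
  fun p _ hθ => h p hθ

/-- **The abstract site closing argument with schemes below one.**  If `p_c^{site}(Γ, x) < 1` and at every density `p < 1` with
`θ^{site}_x(p) > 0` there is a bounded-range history-driven scheme on the star graph, lawful with `ε < 2⁻³²`, whose infinite
macro-cluster forces `x ↔^{site} ∞`, then `θ^{site}_x(p_c^{site}) = 0`. [cite: KozmaNitzan2024, §1 p. 2 (approach 1)] -/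
theorem siteTheta_criticalProb_eq_zero_of_schemes_ltOne {V : Type*} [DecidableEq V] [Countable V] (Γ : SimpleGraph V)
    [Γ.LocallyFinite] {G : SimpleGraph (Option V)} (hG : ∀ v, G.Adj none (some v)) (x : V) (hpc : siteCriticalProb Γ x < 1)
    (h : ∀ p : unitInterval, (p : ℝ) < 1 → 0 < siteTheta Γ x p →
      ∃ (S : HSiteScheme (Option V)) (ε : ℝ) (N : ℕ), S.Lawful G p ε ∧ ε < (1 / 2) ^ 32 ∧
        (∀ hh P, S.E.next hh = some P → P.env.card ≤ N) ∧ (↑S.U₀ : Set (Sym2 (Option V))) ⊆ G.edgeSet ∧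
        S.initEvent ∩ {ω | (S.occFinal ω).Infinite} ⊆ starRead ⁻¹' sitePercolatesAt Γ x ∪ {ω | ¬ω ⊆ G.edgeSet}) :
    siteTheta Γ x ⟨siteCriticalProb Γ x, siteCriticalProb_mem_Icc Γ x⟩ = 0 := by
  by_contra hne
  have hpos : 0 < siteTheta Γ x ⟨siteCriticalProb Γ x, siteCriticalProb_mem_Icc Γ x⟩ :=
    lt_of_le_of_ne measureReal_nonneg (Ne.symm hne)
  obtain ⟨S, ε, N, hL, hε, hN, hU, hperc⟩ := h _ hpc hpos
  have hp0 : 0 < siteCriticalProb Γ x := by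
    rcases (siteCriticalProb_mem_Icc Γ x).1.eq_or_lt with h0 | h0
    · exfalso
      have : siteTheta Γ x ⟨siteCriticalProb Γ x, siteCriticalProb_mem_Icc Γ x⟩ = 0 := by
        have e : (⟨siteCriticalProb Γ x, siteCriticalProb_mem_Icc Γ x⟩ : unitInterval) = 0 := Subtype.ext h0.symm
        rw [e]; exact siteTheta_zero Γ x
      exact hne this
    · exact h0
  exact lt_irrefl _ (siteCriticalProb_lt_of_lawful Γ hG hL hε hN hU hp0 hperc)

/-- **The restricted site witness closes the site target on `ℤ^d`, `d ≥ 2`**: `SiteSamePWitnessLtOneZd d → θ^{site}_{ℤ^d}(p_c^{site}) = 0`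
(uses `p_c^{site}(ℤ^d) < 1`). [cite: KozmaNitzan2024, §1 p. 2 (approach 1)] [cite: BenjaminiSchramm1996, Conj. 4] -/
theorem sitePercolationContinuity_of_siteSamePWitnessLtOneZd (d : ℕ) (hd : 2 ≤ d) (h : SiteSamePWitnessLtOneZd d) :
    SitePercolationContinuity d := by
  have key := siteTheta_criticalProb_eq_zero_of_schemes_ltOne (zdGraph d) (G := (⊤ : SimpleGraph (Option (Site d))))
    top_adj_none_some (0 : Site d) (siteCriticalProb_zd_lt_one hd) h
  have e : (⟨siteCriticalProb (zdGraph d) (0 : Site d), siteCriticalProb_mem_Icc _ _⟩ : unitInterval) = siteCriticalProbI d := rfl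
  rw [e] at key
  exact key

/-- **At `d = 3`: the lane's class-C1a target from the site witness below one.** [cite: BenjaminiSchramm1996, Conj. 4] -/
theorem sitePercolationContinuityZ3_of_siteSamePWitnessLtOneZd (h : SiteSamePWitnessLtOneZd 3) : SitePercolationContinuityZ3 :=
  sitePercolationContinuity_of_siteSamePWitnessLtOneZd 3 (by norm_num) h

end SiteSameP

end Summit.CriticalPhenomena.PercolationContinuityZ3.Theorems.Transplant

end
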